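import Literature.AlgebraicGeometry.Pohlmann1968.SimpleDegenerateCMAbelianVarietiesCompositeDimension
import Literature.NumberTheory.ComplexMultiplication.AbelianCMFieldsCyclicOverImaginaryQuadratic
import HarnessLib

/-!
# Dodson 1984, §3.2.1 as printed: in EVERY composite dimension `n > 4` there exist simple degenerate abelian
# varieties of CM type (of rank `n − l + 2` for each factorisation `n = kl`, `k ≥ 3`, `l ≥ 2`)

B. Dodson, *The structure of Galois groups of CM-fields*, Trans. AMS **283** (1984) [Dodson1984], §3.2.1 (p. 13):

> "THEOREM (A Converse of Ribet's Theorem [15]).  Let `n > 4` be composite and factor `n` as `n = kl`, with `k ≥ 3`,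
> `l ≥ 2`.  Then there exist simple degenerate Abelian varieties of dimension `n` and rank `n − l + 2`."

(Ribet's theorem [15] = [Ribet1980] §3 / Yanai: a simple abelian variety of CM type and PRIME dimension is
nondegenerate — tree `typeRank_eq_of_prime_of_isPrimitive`, `Pohlmann1968.mtRank_hodge_one_eq_of_prime`; together
with Ribet's (3.7) for `n ≤ 3` and the degenerate simple CM FOURFOLDS of Moonen–Zarhin / Dodson §3.3.2 this says:
simple CM abelian varieties with exceptional Hodge classes exist exactly in the composite dimensions `≥ 4`.)

This file only ASSEMBLES: the fields (`NumberTheory/ComplexMultiplication/AbelianCMFieldsCyclicOverImaginaryQuadratic`: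
`Dodson1984.exists_abelianCMField_gal_cyclicTimesConj`), the type, its rank and primitivity and the abelian varieties
(`Pohlmann1968/SimpleDegenerateCMAbelianVarietiesCompositeDimension`: `exists_simple_degenerate_of_gal`,
`exists_simple_degenerate_of_cmAbelianVarietyRealised`), and the arithmetic remark that every composite `n > 4`
factors as `kl` with `k ≥ 3`, `l ≥ 2` (`exists_eq_mul_of_not_prime`).  PROVED:

* `exists_primitive_degenerate_cmType_of_eq_mul` — for `n = kl`, `k ≥ 3`, `l ≥ 2`: a CM field `K` of degree `2n`
  and a PRIMITIVE, DEGENERATE CM type `Φ` of `K` of rank `Rank(K; Φ) = n − l + 2`, every abelian variety of type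
  `(K; Φ)` being SIMPLE of dimension `n` with an exceptional Hodge class on some power;
* `exists_simple_degenerate_of_eq_mul` / `exists_simple_degenerate_of_not_prime` — **Dodson's theorem as printed**,
  granted the existence of abelian varieties of prescribed CM type (Shimura §6.2 Thm. 3 = the tree's record
  `PicardCM.CMAbelianVarietyRealised`, a HYPOTHESIS here, a theorem Summits-side): a SIMPLE abelian variety `A` of CM
  type, `dim A = n`, DEGENERATE of rank `dim MT(H¹(A)) = n − l + 2 < n + 1`, some power of which carries a rational
  `(m, m)`-class outside `Dᵐ ⊗ ℂ`.

Theorems only; no definition, no named fact (claim DODSON-CONVERSE, COR-CM literature seat `pub-hodgecm2`).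

## References

* [Dodson1984] B. Dodson, Trans. AMS 283 (1984), §3.2.1 Theorem, p. 13.
* [Ribet1980] K. Ribet, Mém. SMF 2 (1980), §3.
* [Shimura1998] G. Shimura, *Abelian Varieties with Complex Multiplication and Modular Functions*, §6.2 Thm. 3.
-/

set_option autoImplicit false

noncomputable section

open scoped BigOperators NumberField
open CategoryTheory NumberField

namespace Literature.AlgebraicGeometry.Pohlmann1968

open Literature.NumberTheory.ComplexMultiplication
open Literature.NumberTheory.ComplexMultiplication.Dodson1984
open Literature.AlgebraicGeometry.Motives (AbelianVariety CMType)
open Literature.AlgebraicGeometry.HodgeTheory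
open Literature.AlgebraicGeometry.ComplexMultiplication (IsCMTypeRealisation)
open Literature.Barriers.HodgeConjecture (divisorClassesSpan)

/-- Every composite `n > 4` factors as `n = kl` with `k ≥ 3`, `l ≥ 2` (`l` the least prime factor; `k = 2` would
force `n = 2l ≤ 4`). [cite: Dodson1984, §3.2.1 Theorem] -/
theorem exists_eq_mul_of_not_prime {n : ℕ} (h4 : 4 < n) (hn : ¬n.Prime) :
    ∃ k l : ℕ, 3 ≤ k ∧ 2 ≤ l ∧ n = k * l := by
  have hn2 : 2 ≤ n := by omega
  obtain ⟨l, hl, hln, hmin⟩ : ∃ l : ℕ, l.Prime ∧ l ∣ n ∧ ∀ p : ℕ, p.Prime → p ∣ n → l ≤ p :=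
    ⟨n.minFac, Nat.minFac_prime (by omega), Nat.minFac_dvd n, fun p hp hpn => Nat.minFac_le_of_dvd hp.two_le hpn⟩
  obtain ⟨k, rfl⟩ := hln
  refine ⟨k, l, ?_, hl.two_le, by rw [mul_comm]⟩
  -- `k ≥ 2` since `n` is not prime, and `k ≠ 2` since `n > 4` and `l ≤ k`'s prime factors
  by_contra hk
  push Not at hk
  interval_cases k
  · omega
  · rw [mul_one] at hn; exact hn hl
  · -- `n = 2 l` with `l` the least prime factor: `l ≤ 2`, so `n ≤ 4`
    have h2 : l ≤ 2 := hmin 2 Nat.prime_two (dvd_mul_left 2 l)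
    omega

/-- **Dodson 1984, §3.2.1 — the type.**  For `n = kl`, `k ≥ 3`, `l ≥ 2` there are a CM number field `K` with
`[K : ℚ] = 2n` and a PRIMITIVE CM type `Φ` of `K` which is DEGENERATE of rank `Rank(K; Φ) = n − l + 2`; every
abelian variety of CM type `(K; Φ)` (read on `H¹`) is SIMPLE of dimension `n` and some power of it carries a
rational `(m, m)`-class outside `Dᵐ ⊗ ℂ`. [cite: Dodson1984, §3.2.1 Theorem] -/
theorem exists_primitive_degenerate_cmType_of_eq_mul {n k l : ℕ} (hk : 3 ≤ k) (hl : 2 ≤ l) (hn : n = k * l) :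
    ∃ (K : Type) (_ : Field K) (_ : NumberField K) (_ : IsCMField K) (Φ : CMType K) (φ₀ : K →+* ℂ),
      Module.finrank ℚ K = 2 * n ∧ IsPrimitive (ℂ ≃+* ℂ) Φ.1 φ₀ ∧ cmTypeRank Φ = n - l + 2 ∧
        ¬IsNondegenerate Φ ∧
        ∀ (A : AbelianVariety ℂ) (ι : 𝓞 K →+* End A) (θ : K →+* Module.End ℂ (complexBetti A.X 1)),
          IsCMTypeRealisation Φ A ι θ →
            A.IsSimple ∧ A.dim = n ∧
              ∃ N m : ℕ, ∃ c : complexBetti (⨁ fun _ : Fin N => A).X (2 * m), IsRationalClass c ∧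
                IsOfHodgeType (⨁ fun _ : Fin N => A).dim (⨁ fun _ : Fin N => A).X (2 * m) m m c ∧
                c ∉ divisorClassesSpan (⨁ fun _ : Fin N => A).X (⨁ fun _ : Fin N => A).dim m := by
  have hn0 : 0 < n := by rw [hn]; positivity
  obtain ⟨K, _, _, _, _, ρ, σ, φ₀, hcomm, hρ, hσ, hρσ, hK⟩ := exists_abelianCMField_gal_cyclicTimesConj n hn0
  obtain ⟨Φ, hprim, hrank, hdeg, hAV⟩ := exists_simple_degenerate_of_gal hcomm hρ hσ hρσ hK hk hl hn
  exact ⟨K, inferInstance, inferInstance, inferInstance, Φ, φ₀, hK, hprim, hrank, hdeg, hAV⟩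

/-- **Dodson 1984, §3.2.1 (A Converse of Ribet's Theorem), as printed, for `n = kl`, `k ≥ 3`, `l ≥ 2`**: granted the
existence of abelian varieties of prescribed CM type (Shimura §6.2 Thm. 3, the tree's record
`PicardCM.CMAbelianVarietyRealised`), there is a SIMPLE abelian variety `A` of CM type `(K; Φ)` (`[K : ℚ] = 2n`) with
`dim A = n`, DEGENERATE of rank `dim MT(H¹(A)) = n − l + 2`, some power of which carries an exceptional Hodge class.
[cite: Dodson1984, §3.2.1 Theorem] [cite: Shimura1998, §6.2 Thm. 3] -/
theorem exists_simple_degenerate_of_eq_mul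
    (hreal : Literature.NumberTheory.Automorphic.PicardCM.CMAbelianVarietyRealised) {n k l : ℕ} (hk : 3 ≤ k)
    (hl : 2 ≤ l) (hn : n = k * l) :
    ∃ (K : Type) (_ : Field K) (_ : NumberField K) (_ : IsCMField K) (Φ : CMType K) (A : AbelianVariety ℂ)
      (ι : 𝓞 K →+* End A) (θ : K →+* Module.End ℂ (complexBetti A.X 1)) (hA : IsCMTypeRealisation Φ A ι θ),
      Module.finrank ℚ K = 2 * n ∧ A.IsSimple ∧ A.dim = n ∧
        (haveI := BettiUniverse.finite hA.1 1
         @Motives.HodgeStructure.mtRank _ _ _ Motives.hodgeTensorFacts_holds.{0, 0} _ _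
           (BettiUniverse.hodge exists_isReal_hodgeModel_holds hA.1 1) = n - l + 2) ∧
        ∃ N m : ℕ, ∃ c : complexBetti (⨁ fun _ : Fin N => A).X (2 * m), IsRationalClass c ∧
          IsOfHodgeType (⨁ fun _ : Fin N => A).dim (⨁ fun _ : Fin N => A).X (2 * m) m m c ∧
          c ∉ divisorClassesSpan (⨁ fun _ : Fin N => A).X (⨁ fun _ : Fin N => A).dim m := by
  have hn0 : 0 < n := by rw [hn]; positivity
  obtain ⟨K, _, _, _, _, ρ, σ, φ₀, hcomm, hρ, hσ, hρσ, hK⟩ := exists_abelianCMField_gal_cyclicTimesConj n hn0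
  obtain ⟨Φ, A, ι, θ, hA, hs, hd, hmt, hex⟩ :=
    exists_simple_degenerate_of_cmAbelianVarietyRealised hreal hcomm hρ hσ hρσ hK hk hl hn
  exact ⟨K, inferInstance, inferInstance, inferInstance, Φ, A, ι, θ, hA, hK, hs, hd, hmt, hex⟩

/-- **Dodson 1984, §3.2.1, as printed: "Let `n > 4` be composite […] Then there exist simple degenerate Abelian
varieties of dimension `n`"** (granted `PicardCM.CMAbelianVarietyRealised`): a simple abelian `n`-fold of CM type with
`dim MT(H¹(A)) < n + 1` and an exceptional Hodge class on some power. [cite: Dodson1984, §3.2.1 Theorem]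
[cite: Shimura1998, §6.2 Thm. 3] -/
theorem exists_simple_degenerate_of_not_prime
    (hreal : Literature.NumberTheory.Automorphic.PicardCM.CMAbelianVarietyRealised) {n : ℕ} (h4 : 4 < n)
    (hn : ¬n.Prime) :
    ∃ (K : Type) (_ : Field K) (_ : NumberField K) (_ : IsCMField K) (Φ : CMType K) (A : AbelianVariety ℂ)
      (ι : 𝓞 K →+* End A) (θ : K →+* Module.End ℂ (complexBetti A.X 1)) (hA : IsCMTypeRealisation Φ A ι θ),
      A.IsSimple ∧ A.dim = n ∧
        (haveI := BettiUniverse.finite hA.1 1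
         @Motives.HodgeStructure.mtRank _ _ _ Motives.hodgeTensorFacts_holds.{0, 0} _ _
           (BettiUniverse.hodge exists_isReal_hodgeModel_holds hA.1 1) < n + 1) ∧
        ∃ N m : ℕ, ∃ c : complexBetti (⨁ fun _ : Fin N => A).X (2 * m), IsRationalClass c ∧
          IsOfHodgeType (⨁ fun _ : Fin N => A).dim (⨁ fun _ : Fin N => A).X (2 * m) m m c ∧
          c ∉ divisorClassesSpan (⨁ fun _ : Fin N => A).X (⨁ fun _ : Fin N => A).dim m := by
  obtain ⟨k, l, hk, hl, hkl⟩ := exists_eq_mul_of_not_prime h4 hn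
  obtain ⟨K, _, _, _, Φ, A, ι, θ, hA, -, hs, hd, hmt, hex⟩ := exists_simple_degenerate_of_eq_mul hreal hk hl hkl
  refine ⟨K, inferInstance, inferInstance, inferInstance, Φ, A, ι, θ, hA, hs, hd, ?_, hex⟩
  have hlt : n - l + 2 < n + 1 := by omega
  exact hmt.trans_lt hlt

end Literature.AlgebraicGeometry.Pohlmann1968

end
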